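import Mathlib
import Literature.NumberTheory.Transcendental.Associators
import Literature.NumberTheory.Transcendental.MultipleZetaDuality
import HarnessLib

/-!
# Furusho's theorem "pentagon ⇒ double shuffle", Part A: the regularisation algebra of §4

Sibling file of `Associators.lean`, first part of the proof of the named fact
`furusho_pentagon_doubleShuffle` [Furusho2011, Thm 1.2], following the printed proof (H. Furusho,
*Double shuffle relation for associators*, Ann. of Math. 174 (2011), §4–§5, arXiv:0808.0319).
Everything here is proved; no named facts are introduced.

## Part A. The algebraic half of Furusho's §4 (Prop. 4.2 and the end of §4), parameter-free

Furusho's proof of Thm 1.2/2.1 ends (§4, p. 8–9) by an algebraic argument turning two families of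
identities among the coefficients `l_a(φ) = (-1)^{dp a} c_{…}(φ)` of `φ` — the *series shuffle
formula* `l_a(φ) l_b(φ) = Σ_σ l_{σ(a,b)}(φ)` for admissible `a, b` (from Lemmas 5.1, 5.2) and its
companion with `b = (1,…,1)` in the integral regularisation (Lemmas 5.3, 5.4) — into the
generalised double shuffle relation `Δ_*(φ_*) = φ_* ⊗̂ φ_*`, via Hoffman's harmonic algebra, the
regularisation map `𝕃` and Prop. 4.2 (`l^S = 𝕃(l^I)`). We formalise this step with the parameter
`T` eliminated: only the `T⁰`-coefficients of Furusho's second family are needed, and these read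
`Σ_{u ∈ s ∗ 1^l} l_u(φ) = 0` (`l ≥ 1`, `s` admissible). In the tree's conventions
(`l_a(φ) = NCSeries.piY φ s` with `s` the reversed index, `MZV.stuffle` = harmonic product):

* `MZV.stuffle_perm_comm`, `MZV.sum_stuffle_assoc` — Hoffman's Theorem 2.1 (the harmonic product
  is commutative and associative), in the multiset / summed form used here [Hoffman1997, Thm 2.1];
* `MZV.sum_stuffle_singleton_replicate_one`, `MZV.newton_stuffle_ones` — the harmonic products
  `(c) ∗ 1^j` and Newton's identity `m · 1^m = Σ_{k<m} (-1)^k (k+1) ∗ 1^{m-1-k}` in `𝔥¹`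
  (Furusho §4, proof of Prop. 4.2, first display; [Hoffman1997]);
* `NCSeries.stuffleChar_of_admissible` — the engine: a function `Z` on indices with values in a
  commutative `ℚ`-algebra which is `∗`-multiplicative on (admissible, admissible) and on
  (admissible, `1^l`) pairs and whose values `Z(1^m)` obey Newton's recursion
  `m Z(1^m) = Σ_{k<m} (-1)^k Z(k+1) Z(1^{m-1-k})` is `∗`-multiplicative on all indices
  (this replaces Hoffman's structure theorem `𝔥¹ = 𝔥⁰[y₁]` and the map `𝕃` of Furusho §4);
* `NCSeries.toPowerSeries`, `NCSeries.exp_replicate_recursion` — the coefficients of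
  `φ_corr = exp(Σ ((-1)ⁿ/n) c_{X₀ⁿ⁻¹X₁}(φ) Y₁ⁿ)` satisfy Newton's recursion (`E' = E · C'`);
* `NCSeries.generalisedDoubleShuffle_of_piY` — **Part A assembled**: if `c_∅(φ) = 1`,
  `c_{X₁ʲ}(φ) = 0` (`j ≥ 1`), the convergent series shuffle formula
  `piY φ s · piY φ t = Σ_{u ∈ s ∗ t} piY φ u` holds for admissible `s, t`, and
  `Σ_{u ∈ s ∗ 1^l} piY φ u = 0` for admissible `s ≠ []`, `l ≥ 1`, then
  `NCSeries.GeneralisedDoubleShuffle φ` [Furusho2011, §4 (Prop. 4.2 and end of proof of Thm 2.1)].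

Part B (the geometric half: pentagon ⇒ the two hypotheses of Part A — the bar construction of
`M_{0,5}`, the series shuffle formula for two-variable multiple polylogarithms, Lemmas 5.1–5.4 and
the 5-cycle form of the pentagon, Furusho §3, §5) is not in this file.

## Deliberately NOT here

Hoffman's structure theorems (`𝔥¹ = 𝔥⁰[y₁]`, Thm 3.1/4.1 — only the "peeling" half
`MZV.stuffle_replicate_one_perm` is needed), Furusho's `k[T]`-valued regularisations `l^I`, `l^S` and
the map `𝕃` (replaced by `NCSeries.stuffleChar_of_admissible`), anything about the pentagon.

## References

* H. Furusho, *Double shuffle relation for associators*, Ann. of Math. 174 (2011), 341–360, §4–§5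
  (arXiv:0808.0319, pp. 8–11). [Furusho2011]
* M. E. Hoffman, *The algebra of multiple harmonic series*, J. Algebra 194 (1997), 477–495,
  Thm 2.1, §2–§3. [Hoffman1997]
* K. Ihara, M. Kaneko, D. Zagier, *Derivation and double shuffle relations for multiple zeta
  values*, Compos. Math. 142 (2006), §2–§3 (regularisation). [IharaKanekoZagier2006]
-/

noncomputable section

open scoped BigOperators

namespace Literature.NumberTheory.Transcendental

universe u v

/-! ## A.1 The harmonic algebra in summed form (Hoffman 1997, Thm 2.1) -/

namespace MZV

/-- **Commutativity of the harmonic product** (Hoffman 1997, Thm 2.1): `s ∗ t` and `t ∗ s` are the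
same multiset of indices. [cite: Hoffman1997, Thm 2.1] -/
theorem stuffle_perm_comm : ∀ (s t : List ℕ), (stuffle s t).Perm (stuffle t s)
  | [], t => by cases t <;> simp
  | a :: s, [] => by simp
  | a :: s, b :: t => by
    rw [stuffle_cons_cons, stuffle_cons_cons]
    have h1 := (stuffle_perm_comm s (b :: t)).map (List.cons a)
    have h2 := (stuffle_perm_comm (a :: s) t).map (List.cons b)
    have h3 := (stuffle_perm_comm s t).map (List.cons (a + b))
    rw [Nat.add_comm b a]
    refine (h1.append (h2.append h3)).trans ?_
    simpa only [List.append_assoc] using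
      (List.perm_append_comm (l₁ := (stuffle (b :: t) s).map (List.cons a))
        (l₂ := (stuffle t (a :: s)).map (List.cons b))).append_right
        ((stuffle t s).map (List.cons (a + b)))
  termination_by s t => s.length + t.length

/-- Summed form of commutativity: `Σ_{u ∈ s ∗ t} f u = Σ_{u ∈ t ∗ s} f u`. [cite: Hoffman1997, Thm 2.1] -/
theorem sum_map_stuffle_comm {M : Type*} [AddCommMonoid M] (f : List ℕ → M) (s t : List ℕ) :
    ((stuffle s t).map f).sum = ((stuffle t s).map f).sum :=
  ((stuffle_perm_comm s t).map f).sum_eq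

/-- The summed harmonic product against a test function: `sumStuffle f s t = Σ_{u ∈ s ∗ t} f u`
("`f(s ∗ t)`" for `f` extended linearly). [folklore] -/
def sumStuffle {M : Type*} [AddCommMonoid M] (f : List ℕ → M) (s t : List ℕ) : M :=
  ((stuffle s t).map f).sum

section SumStuffle

variable {M : Type*} [AddCommMonoid M] (f : List ℕ → M)

/-- `f([] ∗ t) = f t`. [folklore] -/
@[simp] theorem sumStuffle_nil_left (t : List ℕ) : sumStuffle f [] t = f t := by
  simp [sumStuffle]

/-- `f(s ∗ []) = f s`. [folklore] -/
@[simp] theorem sumStuffle_nil_right (s : List ℕ) : sumStuffle f s [] = f s := by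
  simp [sumStuffle]

/-- The recursion (A3) in summed form. [cite: Hoffman1997, §2 (A3)] -/
theorem sumStuffle_cons_cons (a b : ℕ) (s t : List ℕ) :
    sumStuffle f (a :: s) (b :: t) =
      sumStuffle (f ∘ List.cons a) s (b :: t) + sumStuffle (f ∘ List.cons b) (a :: s) t +
        sumStuffle (f ∘ List.cons (a + b)) s t := by
  simp [sumStuffle, stuffle_cons_cons, List.map_map, add_assoc]

/-- `f(s ∗ t) = f(t ∗ s)`. [cite: Hoffman1997, Thm 2.1] -/
theorem sumStuffle_comm (s t : List ℕ) : sumStuffle f s t = sumStuffle f t s :=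
  sum_map_stuffle_comm f s t

/-- `sumStuffle` is additive in the test function. [folklore] -/
theorem sumStuffle_add (g : List ℕ → M) (s t : List ℕ) :
    sumStuffle (f + g) s t = sumStuffle f s t + sumStuffle g s t := by
  simp only [sumStuffle, Pi.add_def]
  exact List.sum_map_add

end SumStuffle

/-- **Associativity of the harmonic product** (Hoffman 1997, Thm 2.1) in summed form:
`Σ_{u ∈ s ∗ t} Σ_{w ∈ u ∗ r} f w = Σ_{v ∈ t ∗ r} Σ_{w ∈ s ∗ v} f w`, i.e. `f((s ∗ t) ∗ r) = f(s ∗ (t ∗ r))`.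
Hoffman's proof: both sides expand, by (A3) in the first letters `a, b, c` of `s, t, r`, into the
same seven terms headed by `a, b, c, a+b, a+c, b+c, a+b+c`. [cite: Hoffman1997, Thm 2.1] -/
theorem sum_stuffle_assoc {M : Type*} [AddCommMonoid M] :
    ∀ (n : ℕ) (f : List ℕ → M) (s t r : List ℕ), s.length + t.length + r.length ≤ n →
      ((stuffle s t).map fun u => sumStuffle f u r).sum =
        ((stuffle t r).map fun v => sumStuffle f s v).sum := by
  intro n
  induction n with
  | zero =>
    intro f s t r h
    have hs : s = [] := List.eq_nil_of_length_eq_zero (by omega)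
    subst hs
    simp [sumStuffle]
  | succ n ih =>
    intro f s t r h
    match s, t, r with
    | [], t, r => simp [sumStuffle]
    | a :: s, [], r => simp [sumStuffle]
    | a :: s, b :: t, [] => simp [sumStuffle]
    | a :: s, b :: t, c :: r =>
      simp only [List.length_cons] at h
      -- expand the outer products by (A3) and the inner ones by (A3) again
      rw [stuffle_cons_cons, stuffle_cons_cons]
      simp only [List.map_append, List.map_map, List.sum_append]
      have e1 : ((stuffle s (b :: t)).map ((fun u => sumStuffle f u (c :: r)) ∘ List.cons a)).sum =
          ((stuffle s (b :: t)).map fun u => sumStuffle (f ∘ List.cons a) u (c :: r)).sum +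
          ((stuffle s (b :: t)).map fun u => sumStuffle (f ∘ List.cons c) (a :: u) r).sum +
          ((stuffle s (b :: t)).map fun u => sumStuffle (f ∘ List.cons (a + c)) u r).sum := by
        rw [← List.sum_map_add, ← List.sum_map_add]
        refine congrArg List.sum (List.map_congr_left fun u _ => ?_)
        simp [sumStuffle_cons_cons]
      have e2 : ((stuffle (a :: s) t).map ((fun u => sumStuffle f u (c :: r)) ∘ List.cons b)).sum =
          ((stuffle (a :: s) t).map fun u => sumStuffle (f ∘ List.cons b) u (c :: r)).sum +
          ((stuffle (a :: s) t).map fun u => sumStuffle (f ∘ List.cons c) (b :: u) r).sum +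
          ((stuffle (a :: s) t).map fun u => sumStuffle (f ∘ List.cons (b + c)) u r).sum := by
        rw [← List.sum_map_add, ← List.sum_map_add]
        refine congrArg List.sum (List.map_congr_left fun u _ => ?_)
        simp [sumStuffle_cons_cons]
      have e3 : ((stuffle s t).map ((fun u => sumStuffle f u (c :: r)) ∘ List.cons (a + b))).sum =
          ((stuffle s t).map fun u => sumStuffle (f ∘ List.cons (a + b)) u (c :: r)).sum +
          ((stuffle s t).map fun u => sumStuffle (f ∘ List.cons c) ((a + b) :: u) r).sum +
          ((stuffle s t).map fun u => sumStuffle (f ∘ List.cons (a + b + c)) u r).sum := by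
        rw [← List.sum_map_add, ← List.sum_map_add]
        refine congrArg List.sum (List.map_congr_left fun u _ => ?_)
        simp [sumStuffle_cons_cons]
      have e4 : ((stuffle t (c :: r)).map ((fun v => sumStuffle f (a :: s) v) ∘ List.cons b)).sum =
          ((stuffle t (c :: r)).map fun v => sumStuffle (f ∘ List.cons a) s (b :: v)).sum +
          ((stuffle t (c :: r)).map fun v => sumStuffle (f ∘ List.cons b) (a :: s) v).sum +
          ((stuffle t (c :: r)).map fun v => sumStuffle (f ∘ List.cons (a + b)) s v).sum := by
        rw [← List.sum_map_add, ← List.sum_map_add]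
        refine congrArg List.sum (List.map_congr_left fun v _ => ?_)
        simp [sumStuffle_cons_cons]
      have e5 : ((stuffle (b :: t) r).map ((fun v => sumStuffle f (a :: s) v) ∘ List.cons c)).sum =
          ((stuffle (b :: t) r).map fun v => sumStuffle (f ∘ List.cons a) s (c :: v)).sum +
          ((stuffle (b :: t) r).map fun v => sumStuffle (f ∘ List.cons c) (a :: s) v).sum +
          ((stuffle (b :: t) r).map fun v => sumStuffle (f ∘ List.cons (a + c)) s v).sum := by
        rw [← List.sum_map_add, ← List.sum_map_add]
        refine congrArg List.sum (List.map_congr_left fun v _ => ?_)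
        simp [sumStuffle_cons_cons]
      have e6 : ((stuffle t r).map ((fun v => sumStuffle f (a :: s) v) ∘ List.cons (b + c))).sum =
          ((stuffle t r).map fun v => sumStuffle (f ∘ List.cons a) s ((b + c) :: v)).sum +
          ((stuffle t r).map fun v => sumStuffle (f ∘ List.cons (b + c)) (a :: s) v).sum +
          ((stuffle t r).map fun v => sumStuffle (f ∘ List.cons (a + (b + c))) s v).sum := by
        rw [← List.sum_map_add, ← List.sum_map_add]
        refine congrArg List.sum (List.map_congr_left fun v _ => ?_)
        simp [sumStuffle_cons_cons]
      rw [e1, e2, e3, e4, e5, e6]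
      -- the "middle" terms of e1,e2,e3 reassemble Σ_{u ∈ as ∗ bt} (f∘c)(u ∗ r)
      have m123 : ((stuffle s (b :: t)).map fun u => sumStuffle (f ∘ List.cons c) (a :: u) r).sum +
          ((stuffle (a :: s) t).map fun u => sumStuffle (f ∘ List.cons c) (b :: u) r).sum +
          ((stuffle s t).map fun u => sumStuffle (f ∘ List.cons c) ((a + b) :: u) r).sum =
          ((stuffle (a :: s) (b :: t)).map fun u => sumStuffle (f ∘ List.cons c) u r).sum := by
        rw [stuffle_cons_cons]
        simp only [List.map_append, List.map_map, List.sum_append, Function.comp_def, add_assoc]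
      -- the "first" terms of e4,e5,e6 reassemble Σ_{v ∈ bt ∗ cr} (f∘a)(s ∗ v)
      have m456 : ((stuffle t (c :: r)).map fun v => sumStuffle (f ∘ List.cons a) s (b :: v)).sum +
          ((stuffle (b :: t) r).map fun v => sumStuffle (f ∘ List.cons a) s (c :: v)).sum +
          ((stuffle t r).map fun v => sumStuffle (f ∘ List.cons a) s ((b + c) :: v)).sum =
          ((stuffle (b :: t) (c :: r)).map fun v => sumStuffle (f ∘ List.cons a) s v).sum := by
        rw [stuffle_cons_cons]
        simp only [List.map_append, List.map_map, List.sum_append, Function.comp_def, add_assoc]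
      -- induction hypotheses (seven smaller triples)
      have i1 := ih (f ∘ List.cons a) s (b :: t) (c :: r) (by simp only [List.length_cons]; omega)
      have i2 := ih (f ∘ List.cons b) (a :: s) t (c :: r) (by simp only [List.length_cons]; omega)
      have i3 := ih (f ∘ List.cons (a + b)) s t (c :: r) (by simp only [List.length_cons]; omega)
      have i4 := ih (f ∘ List.cons c) (a :: s) (b :: t) r (by simp only [List.length_cons]; omega)
      have i5 := ih (f ∘ List.cons (a + c)) s (b :: t) r (by simp only [List.length_cons]; omega)
      have i6 := ih (f ∘ List.cons (b + c)) (a :: s) t r (by simp only [List.length_cons]; omega)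
      have i7 := ih (f ∘ List.cons (a + b + c)) s t r (by omega)
      rw [show a + (b + c) = a + b + c from (add_assoc a b c).symm]
      have hM : ((stuffle s (b :: t)).map fun u => sumStuffle (f ∘ List.cons c) (a :: u) r).sum +
          ((stuffle (a :: s) t).map fun u => sumStuffle (f ∘ List.cons c) (b :: u) r).sum +
          ((stuffle s t).map fun u => sumStuffle (f ∘ List.cons c) ((a + b) :: u) r).sum =
          ((stuffle (b :: t) r).map fun v => sumStuffle (f ∘ List.cons c) (a :: s) v).sum := by
        rw [m123, i4]
      rw [i1, i2, i3, i5, i6, i7, ← hM, ← m456]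
      abel

/-- Associativity, packaged: `Σ_{u ∈ s ∗ t} f(u ∗ r) = Σ_{v ∈ t ∗ r} f(s ∗ v)`. [cite: Hoffman1997, Thm 2.1] -/
theorem sumStuffle_assoc {M : Type*} [AddCommMonoid M] (f : List ℕ → M) (s t r : List ℕ) :
    ((stuffle s t).map fun u => sumStuffle f u r).sum =
      ((stuffle t r).map fun v => sumStuffle f s v).sum :=
  sum_stuffle_assoc _ f s t r le_rfl


/-! ## A.2 Leading ones, `(c) ∗ 1ʲ`, and Newton's identity in `𝔥¹` -/

/-- The number of leading `1`s of an index (the tree's indices are the REVERSES of Furusho's, so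
these are his trailing `1`s, the non-admissible tail). [folklore] -/
def leadOnes : List ℕ → ℕ
  | [] => 0
  | a :: w => if a = 1 then leadOnes w + 1 else 0

/-- `leadOnes [] = 0`. [folklore] -/
@[simp] theorem leadOnes_nil : leadOnes [] = 0 := rfl

/-- `leadOnes (1 w) = leadOnes w + 1`. [folklore] -/
@[simp] theorem leadOnes_cons_one (w : List ℕ) : leadOnes (1 :: w) = leadOnes w + 1 := by
  simp [leadOnes]

/-- `leadOnes (a w) = 0` for `a ≠ 1`. [folklore] -/
theorem leadOnes_cons_of_ne {a : ℕ} (ha : a ≠ 1) (w : List ℕ) : leadOnes (a :: w) = 0 := by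
  simp [leadOnes, ha]

/-- `leadOnes (1^l s) = l` for `s` admissible. [folklore] -/
theorem leadOnes_replicate_append {s : List ℕ} (hs : IsAdmissible s) (l : ℕ) :
    leadOnes (List.replicate l 1 ++ s) = l := by
  induction l with
  | zero =>
    cases s with
    | nil => simp
    | cons a w =>
      have ha : 2 ≤ a := by simpa using hs.2 (List.cons_ne_nil a w)
      simpa using leadOnes_cons_of_ne (show a ≠ 1 by omega) w
  | succ l ih => simpa [List.replicate_succ] using ih

/-- Every index is `1^{leadOnes v}` followed by its tail `v.drop (leadOnes v)`. [folklore] -/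
theorem replicate_leadOnes_append_drop : ∀ v : List ℕ,
    List.replicate (leadOnes v) 1 ++ v.drop (leadOnes v) = v
  | [] => rfl
  | a :: w => by
    by_cases ha : a = 1
    · subst ha
      simpa [List.replicate_succ] using replicate_leadOnes_append_drop w
    · simp [leadOnes_cons_of_ne ha]

/-- The tail after the leading `1`s of an index with positive entries is admissible. [folklore] -/
theorem isAdmissible_drop_leadOnes : ∀ {v : List ℕ}, (∀ i ∈ v, 1 ≤ i) →
    IsAdmissible (v.drop (leadOnes v))
  | [], _ => by simpa using isAdmissible_nil
  | a :: w, hv => by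
    by_cases ha : a = 1
    · subst ha
      simpa using isAdmissible_drop_leadOnes (v := w) fun i hi => hv i (List.mem_cons_of_mem _ hi)
    · rw [leadOnes_cons_of_ne ha, List.drop_zero]
      have ha1 : 1 ≤ a := hv a (by simp)
      exact ⟨hv, fun _ => by simp only [List.head_cons]; omega⟩

/-- **Peeling the leading ones**: for `s` admissible, the harmonic product `s ∗ 1^l` consists of
the index `1^l s` (once) and of indices with fewer than `l` leading `1`s — the existence half of
Hoffman's `𝔥¹ = 𝔥⁰[y₁]` (Hoffman 1997, Thm 3.1; Furusho §4, induction in the proof of Prop. 4.2).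
[cite: Hoffman1997, Thm 3.1] -/
theorem stuffle_replicate_one_perm {s : List ℕ} (hs : IsAdmissible s) : ∀ l : ℕ,
    ∃ rest : List (List ℕ), (stuffle s (List.replicate l 1)).Perm
      ((List.replicate l 1 ++ s) :: rest) ∧ ∀ u ∈ rest, leadOnes u < l
  | 0 => ⟨[], by simp, by simp⟩
  | l + 1 => by
    cases s with
    | nil => exact ⟨[], by simp, by simp⟩
    | cons a w =>
      have ha : 2 ≤ a := by simpa using hs.2 (List.cons_ne_nil a w)
      obtain ⟨rest, hperm, hrest⟩ := stuffle_replicate_one_perm hs l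
      refine ⟨rest.map (List.cons 1) ++ ((stuffle w (List.replicate (l + 1) 1)).map (List.cons a) ++
        (stuffle w (List.replicate l 1)).map (List.cons (a + 1))), ?_, ?_⟩
      · rw [List.replicate_succ, stuffle_cons_cons, ← List.replicate_succ]
        have hmid : ((stuffle (a :: w) (List.replicate l 1)).map (List.cons 1)).Perm
            ((List.replicate (l + 1) 1 ++ a :: w) :: rest.map (List.cons 1)) := by
          simpa [List.replicate_succ] using hperm.map (List.cons 1)
        refine ((hmid.append_right _).append_left _).trans (List.perm_middle.trans ?_)
        refine List.Perm.cons _ ?_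
        simpa only [List.append_assoc, List.append_eq] using
          (List.perm_append_comm (l₁ := (stuffle w (List.replicate (l + 1) 1)).map (List.cons a))
            (l₂ := rest.map (List.cons 1))).append_right
            ((stuffle w (List.replicate l 1)).map (List.cons (a + 1)))
      · intro u hu
        simp only [List.mem_append, List.mem_map] at hu
        rcases hu with ⟨u', hu', rfl⟩ | ⟨u', -, rfl⟩ | ⟨u', -, rfl⟩
        · simpa using hrest u' hu'
        · rw [leadOnes_cons_of_ne (by omega)]; omega
        · rw [leadOnes_cons_of_ne (by omega)]; omega

/-- Summed form of `MZV.stuffle_replicate_one_perm`: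
`Σ_{u ∈ s ∗ 1^l} g u = g(1^l s) + Σ_{u ∈ rest} g u`. [cite: Hoffman1997, Thm 3.1] -/
theorem sumStuffle_replicate_one_eq {M : Type*} [AddCommMonoid M] (g : List ℕ → M) {s : List ℕ}
    {l : ℕ} {rest : List (List ℕ)}
    (hperm : (stuffle s (List.replicate l 1)).Perm ((List.replicate l 1 ++ s) :: rest)) :
    sumStuffle g s (List.replicate l 1) = g (List.replicate l 1 ++ s) + (rest.map g).sum := by
  rw [sumStuffle, (hperm.map g).sum_eq, List.map_cons, List.sum_cons]

/-- **The harmonic product `(c) ∗ 1ʲ`**: the `j + 1` insertions `(1ⁱ, c, 1^{j-i})` plus the `j`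
contractions `(1ⁱ, c + 1, 1^{j-1-i})` (Hoffman 1997, §2 (A1)–(A3)). [cite: Hoffman1997, §2] -/
theorem sumStuffle_singleton_replicate_one {M : Type*} [AddCommMonoid M] (f : List ℕ → M) (c : ℕ) :
    ∀ j : ℕ, sumStuffle f [c] (List.replicate j 1) =
      ∑ i ∈ Finset.range (j + 1), f (List.replicate i 1 ++ c :: List.replicate (j - i) 1) +
        ∑ i ∈ Finset.range j, f (List.replicate i 1 ++ (c + 1) :: List.replicate (j - (i + 1)) 1)
  | 0 => by simp [sumStuffle]
  | j + 1 => by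
    rw [List.replicate_succ, sumStuffle_cons_cons, sumStuffle_nil_left, sumStuffle_nil_left,
      sumStuffle_singleton_replicate_one (f ∘ List.cons 1) c j,
      Finset.sum_range_succ' (fun i => f (List.replicate i 1 ++ c :: List.replicate (j + 1 - i) 1)),
      Finset.sum_range_succ'
        (fun i => f (List.replicate i 1 ++ (c + 1) :: List.replicate (j + 1 - (i + 1)) 1))]
    simp only [Function.comp_apply, List.replicate_succ, List.cons_append, List.replicate_zero,
      List.nil_append, Nat.add_sub_add_right, Nat.sub_zero, Nat.add_sub_cancel]
    abel

/-- **Newton's identity in the harmonic algebra** (Furusho §4, first display in the proof of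
Prop. 4.2; Hoffman): `(m+1) · f(1^{m+1}) = Σ_{k=0}^{m} (-1)^k f((k+1) ∗ 1^{m-k})` for every `f`,
i.e. `(m+1) y₁^{m+1} = Σ_k (-1)^k y_{k+1} ∗ y₁^{m-k}` in `𝔥¹`: the rows `(k+1) ∗ 1^{m-k}` are
`A_k + A_{k+1}` with `A_k` the insertions of `k+1` into `1^{m-k}`, and the alternating sum
telescopes to `A_0 = (m+1) · 1^{m+1}`. [cite: Furusho2011, §4 (proof of Prop. 4.2)] -/
theorem newton_sumStuffle {K : Type*} [CommRing K] (f : List ℕ → K) (m : ℕ) :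
    ((m + 1 : ℕ) : K) * f (List.replicate (m + 1) 1) =
      ∑ k ∈ Finset.range (m + 1), (-1) ^ k * sumStuffle f [k + 1] (List.replicate (m - k) 1) := by
  set A : ℕ → K := fun k => ∑ i ∈ Finset.range (m - k + 1),
    f (List.replicate i 1 ++ (k + 1) :: List.replicate (m - k - i) 1) with hA
  have hrow : ∀ k, k < m →
      sumStuffle f [k + 1] (List.replicate (m - k) 1) = A k + A (k + 1) := by
    intro k hk
    rw [sumStuffle_singleton_replicate_one f (k + 1) (m - k)]
    simp only [hA]
    congr 1
    rw [show m - (k + 1) + 1 = m - k by omega]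
    refine Finset.sum_congr rfl fun i _ => ?_
    rw [show m - k - (i + 1) = m - (k + 1) - i by omega]
  have hlast : sumStuffle f [m + 1] (List.replicate (m - m) 1) = A m := by
    rw [sumStuffle_singleton_replicate_one f (m + 1) (m - m)]
    simp only [hA, Nat.sub_self, Finset.sum_range_zero, add_zero]
  have hA0 : A 0 = ((m + 1 : ℕ) : K) * f (List.replicate (m + 1) 1) := by
    simp only [hA, Nat.sub_zero, zero_add]
    have hcst : ∀ i ∈ Finset.range (m + 1),
        f (List.replicate i 1 ++ 1 :: List.replicate (m - i) 1) = f (List.replicate (m + 1) 1) := by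
      intro i hi
      rw [Finset.mem_range] at hi
      rw [show (1 :: List.replicate (m - i) 1 : List ℕ) = List.replicate (m - i + 1) 1 from rfl,
        List.replicate_append_replicate, show i + (m - i + 1) = m + 1 by omega]
    rw [Finset.sum_congr rfl hcst, Finset.sum_const, Finset.card_range, nsmul_eq_mul]
  have htel : ∀ k, ∑ j ∈ Finset.range k, (-1 : K) ^ j * (A j + A (j + 1)) + (-1) ^ k * A k =
      A 0 := by
    intro k
    induction k with
    | zero => simp
    | succ k ih =>
      rw [Finset.sum_range_succ, pow_succ]
      linear_combination ih
  rw [← hA0, Finset.sum_range_succ, Finset.sum_congr rfl fun k hk => by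
    rw [hrow k (Finset.mem_range.mp hk)], hlast]
  exact (htel m).symm

end MZV

/-! ## A.3 The regularisation engine (replaces Hoffman's `𝔥¹ = 𝔥⁰[y₁]` and Furusho's map `𝕃`) -/

namespace NCSeries

open MZV

section Engine

variable {K : Type*} [CommRing K] (Z : List ℕ → K)

/-- Step 1 (𝔥⁰-linearity): if `Z` is `∗`-multiplicative on (admissible, admissible) and on
(admissible, `1^l`) pairs, then `Z s Z v = Z(s ∗ v)` for `s` admissible and EVERY index `v` with
positive entries — by induction on the leading ones of `v`, peeling them with
`MZV.stuffle_replicate_one_perm` and reassociating (Furusho §4, induction in the proof of Prop. 4.2).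
[cite: Furusho2011, §4 (Prop. 4.2)] -/
theorem stuffleChar_admissible_left
    (h1 : ∀ s t, IsAdmissible s → IsAdmissible t → Z s * Z t = sumStuffle Z s t)
    (h2 : ∀ s, IsAdmissible s → ∀ l : ℕ,
      Z s * Z (List.replicate l 1) = sumStuffle Z s (List.replicate l 1)) :
    ∀ (v : List ℕ), (∀ i ∈ v, 1 ≤ i) → ∀ s, IsAdmissible s → Z s * Z v = sumStuffle Z s v := by
  suffices H : ∀ (n : ℕ) (v : List ℕ), (∀ i ∈ v, 1 ≤ i) → leadOnes v = n →
      ∀ s, IsAdmissible s → Z s * Z v = sumStuffle Z s v from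
    fun v hv s hs => H _ v hv rfl s hs
  intro n
  induction n using Nat.strong_induction_on with
  | _ n ih =>
    intro v hv hn s hs
    set v' := v.drop (leadOnes v) with hv'def
    have hv' : IsAdmissible v' := isAdmissible_drop_leadOnes hv
    have hvdec : List.replicate n 1 ++ v' = v := hn ▸ replicate_leadOnes_append_drop v
    obtain ⟨rest, hperm, hrest⟩ := stuffle_replicate_one_perm hv' n
    have hrestpos : ∀ x ∈ rest, ∀ i ∈ x, 1 ≤ i := fun x hx =>
      one_le_of_mem_stuffle v' _ hv'.1 (fun i hi => by rw [List.eq_of_mem_replicate hi]) x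
        (hperm.symm.subset (List.mem_cons_of_mem _ hx))
    have eZ : Z v' * Z (List.replicate n 1) = Z v + (rest.map Z).sum := by
      rw [h2 v' hv' n, sumStuffle_replicate_one_eq Z hperm, hvdec]
    have eS : ((stuffle v' (List.replicate n 1)).map fun x => sumStuffle Z s x).sum =
        sumStuffle Z s v + (rest.map fun x => sumStuffle Z s x).sum := by
      rw [← sumStuffle, sumStuffle_replicate_one_eq _ hperm, hvdec]
    have ihrest : (rest.map fun x => Z s * Z x).sum = (rest.map fun x => sumStuffle Z s x).sum := by
      refine congrArg List.sum (List.map_congr_left fun x hx => ?_)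
      exact ih (leadOnes x) (hn ▸ hrest x hx) x (hrestpos x hx) rfl s hs
    have eA : sumStuffle Z s v' * Z (List.replicate n 1) =
        ((stuffle v' (List.replicate n 1)).map fun x => sumStuffle Z s x).sum := by
      rw [← sumStuffle_assoc, sumStuffle, ← List.sum_map_mul_right]
      refine congrArg List.sum (List.map_congr_left fun w hw => ?_)
      exact h2 w (isAdmissible_of_mem_stuffle hs hv' hw) n
    have eZ' : Z v = Z v' * Z (List.replicate n 1) - (rest.map Z).sum := by rw [eZ]; ring
    calc Z s * Z v = Z s * Z v' * Z (List.replicate n 1) - (rest.map fun x => Z s * Z x).sum := by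
          rw [List.sum_map_mul_left, eZ']; ring
      _ = sumStuffle Z s v := by rw [h1 s v' hs hv', eA, eS, ihrest]; ring

/-- Step 2 (peeling lemma): granted Step 1, an index `a` (positive entries) which multiplies
correctly with all `1^l` multiplies correctly with every index. [cite: Furusho2011, §4 (Prop. 4.2)] -/
theorem stuffleChar_of_ones
    (hadm : ∀ (v : List ℕ), (∀ i ∈ v, 1 ≤ i) → ∀ s, IsAdmissible s → Z s * Z v = sumStuffle Z s v)
    {a : List ℕ} (ha : ∀ i ∈ a, 1 ≤ i)
    (hO : ∀ l : ℕ, Z a * Z (List.replicate l 1) = sumStuffle Z a (List.replicate l 1)) :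
    ∀ (v : List ℕ), (∀ i ∈ v, 1 ≤ i) → Z a * Z v = sumStuffle Z a v := by
  suffices H : ∀ (n : ℕ) (v : List ℕ), (∀ i ∈ v, 1 ≤ i) → leadOnes v = n →
      Z a * Z v = sumStuffle Z a v from fun v hv => H _ v hv rfl
  intro n
  induction n using Nat.strong_induction_on with
  | _ n ih =>
    intro v hv hn
    set v' := v.drop (leadOnes v) with hv'def
    have hv' : IsAdmissible v' := isAdmissible_drop_leadOnes hv
    have hvdec : List.replicate n 1 ++ v' = v := hn ▸ replicate_leadOnes_append_drop v
    obtain ⟨rest, hperm, hrest⟩ := stuffle_replicate_one_perm hv' n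
    have hones : ∀ l : ℕ, ∀ i ∈ List.replicate l 1, 1 ≤ i := fun l i hi => by
      rw [List.eq_of_mem_replicate hi]
    have hrestpos : ∀ x ∈ rest, ∀ i ∈ x, 1 ≤ i := fun x hx =>
      one_le_of_mem_stuffle v' _ hv'.1 (hones n) x (hperm.symm.subset (List.mem_cons_of_mem _ hx))
    have eZ : Z v' * Z (List.replicate n 1) = Z v + (rest.map Z).sum := by
      rw [hadm (List.replicate n 1) (hones n) v' hv', sumStuffle_replicate_one_eq Z hperm, hvdec]
    have eS : ((stuffle v' (List.replicate n 1)).map fun x => sumStuffle Z a x).sum =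
        sumStuffle Z a v + (rest.map fun x => sumStuffle Z a x).sum := by
      rw [← sumStuffle, sumStuffle_replicate_one_eq _ hperm, hvdec]
    have ihrest : (rest.map fun x => Z a * Z x).sum = (rest.map fun x => sumStuffle Z a x).sum := by
      refine congrArg List.sum (List.map_congr_left fun x hx => ?_)
      exact ih (leadOnes x) (hn ▸ hrest x hx) x (hrestpos x hx) rfl
    -- Z v' · Z(a ∗ 1ⁿ) = Σ_{x ∈ a ∗ 1ⁿ} Z(v' ∗ x) = Σ_{u ∈ v' ∗ a} Z(u ∗ 1ⁿ) = Σ_{u ∈ a ∗ v'} … = Σ_{x ∈ v' ∗ 1ⁿ} Z(a ∗ x)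
    have eA : Z v' * sumStuffle Z a (List.replicate n 1) =
        ((stuffle v' (List.replicate n 1)).map fun x => sumStuffle Z a x).sum := by
      rw [sumStuffle, ← List.sum_map_mul_left]
      have hx : ∀ x ∈ stuffle a (List.replicate n 1), Z v' * Z x = sumStuffle Z v' x := fun x hx =>
        hadm x (one_le_of_mem_stuffle a _ ha (hones n) x hx) v' hv'
      rw [List.map_congr_left hx, ← sumStuffle_assoc, sum_map_stuffle_comm, sumStuffle_assoc]
    have eZ' : Z v = Z v' * Z (List.replicate n 1) - (rest.map Z).sum := by rw [eZ]; ring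
    calc Z a * Z v = Z v' * (Z a * Z (List.replicate n 1)) - (rest.map fun x => Z a * Z x).sum := by
          rw [List.sum_map_mul_left, eZ']; ring
      _ = sumStuffle Z a v := by rw [hO n, eA, eS, ihrest]; ring

variable [Algebra ℚ K]

omit [Algebra ℚ K] in
/-- Step 3: Newton's recursion for the values `Z(1^m)` forces `Z(y₁) Z(1^m) = Z(y₁ ∗ 1^m)`
(compare Newton's identity `MZV.newton_sumStuffle` under `Z` with the recursion; the rows
`k ≥ 1` agree by the (admissible, `1^l`) hypothesis). [cite: Furusho2011, §4 (Prop. 4.2)] -/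
theorem stuffleChar_one_ones
    (h2 : ∀ s, IsAdmissible s → ∀ l : ℕ,
      Z s * Z (List.replicate l 1) = sumStuffle Z s (List.replicate l 1))
    (hN : ∀ m : ℕ, ((m + 1 : ℕ) : K) * Z (List.replicate (m + 1) 1) =
      ∑ k ∈ Finset.range (m + 1), (-1) ^ k * (Z [k + 1] * Z (List.replicate (m - k) 1)))
    (m : ℕ) : Z [1] * Z (List.replicate m 1) = sumStuffle Z [1] (List.replicate m 1) := by
  have hn := newton_sumStuffle Z m
  rw [hN m, Finset.sum_range_succ', Finset.sum_range_succ'] at hn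
  have hrows : ∑ k ∈ Finset.range m, (-1 : K) ^ (k + 1) *
      (Z [k + 1 + 1] * Z (List.replicate (m - (k + 1)) 1)) =
      ∑ k ∈ Finset.range m, (-1 : K) ^ (k + 1) *
        sumStuffle Z [k + 1 + 1] (List.replicate (m - (k + 1)) 1) := by
    refine Finset.sum_congr rfl fun k _ => ?_
    rw [h2 [k + 1 + 1] ⟨fun i hi => by simp at hi; omega, fun _ => by simp⟩]
  rw [hrows] at hn
  simpa using hn

/-- In a `ℚ`-algebra, `(m+1) x = (m+1) y` implies `x = y`. [folklore] -/
theorem nat_succ_mul_cancel {x y : K} (m : ℕ) (h : ((m + 1 : ℕ) : K) * x = ((m + 1 : ℕ) : K) * y) :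
    x = y := by
  have hinv : algebraMap ℚ K (1 / (m + 1 : ℚ)) * ((m + 1 : ℕ) : K) = 1 := by
    rw [← map_natCast (algebraMap ℚ K), ← map_mul, ← map_one (algebraMap ℚ K)]
    congr 1
    push_cast
    field_simp
  calc x = algebraMap ℚ K (1 / (m + 1 : ℚ)) * ((m + 1 : ℕ) : K) * x := by rw [hinv, one_mul]
    _ = algebraMap ℚ K (1 / (m + 1 : ℚ)) * ((m + 1 : ℕ) : K) * y := by rw [mul_assoc, h, ← mul_assoc]
    _ = y := by rw [hinv, one_mul]

/-- **The regularisation engine** (our replacement for Hoffman's structure theorem `𝔥¹ = 𝔥⁰[y₁]`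
and Furusho's comparison map `𝕃`, §4): a `K`-valued function `Z` on indices (`K` a commutative
`ℚ`-algebra, `Z(∅) = 1`) which is `∗`-multiplicative on (admissible, admissible) and
(admissible, `1^l`) pairs, and whose values on `1^m` obey Newton's recursion
`(m+1) Z(1^{m+1}) = Σ_{k ≤ m} (-1)^k Z(k+1) Z(1^{m-k})`, is `∗`-multiplicative on all pairs of
indices with positive entries. Steps: 𝔥⁰-linearity; `y₁`; `1^m` by induction on `m` through
Newton's identity applied to `Z` and to `x ↦ Z(x ∗ v)`; general indices by peeling.
[cite: Furusho2011, §4 (Prop. 4.2 and end of the proof of Thm 2.1)] -/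
theorem stuffleChar_of_admissible (h0 : Z [] = 1)
    (h1 : ∀ s t, IsAdmissible s → IsAdmissible t → Z s * Z t = sumStuffle Z s t)
    (h2 : ∀ s, IsAdmissible s → ∀ l : ℕ,
      Z s * Z (List.replicate l 1) = sumStuffle Z s (List.replicate l 1))
    (hN : ∀ m : ℕ, ((m + 1 : ℕ) : K) * Z (List.replicate (m + 1) 1) =
      ∑ k ∈ Finset.range (m + 1), (-1) ^ k * (Z [k + 1] * Z (List.replicate (m - k) 1)))
    (u v : List ℕ) (hu : ∀ i ∈ u, 1 ≤ i) (hv : ∀ i ∈ v, 1 ≤ i) :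
    Z u * Z v = sumStuffle Z u v := by
  have hadm := stuffleChar_admissible_left Z h1 h2
  have hones : ∀ l : ℕ, ∀ i ∈ List.replicate l 1, 1 ≤ i := fun l i hi => by
    rw [List.eq_of_mem_replicate hi]
  -- singletons `[k+1]` multiply correctly with everything
  have hsing : ∀ (k : ℕ) (v : List ℕ), (∀ i ∈ v, 1 ≤ i) → Z [k + 1] * Z v = sumStuffle Z [k + 1] v := by
    intro k
    refine stuffleChar_of_ones Z hadm (a := [k + 1]) (by simp) fun l => ?_
    rcases k with _ | k
    · exact stuffleChar_one_ones Z h2 hN l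
    · exact h2 [k + 1 + 1] ⟨by simp, fun _ => by simp⟩ l
  -- `1^m` multiplies correctly with everything, by induction on `m`
  have hrep : ∀ (m : ℕ) (v : List ℕ), (∀ i ∈ v, 1 ≤ i) →
      Z (List.replicate m 1) * Z v = sumStuffle Z (List.replicate m 1) v := by
    intro m
    induction m using Nat.strong_induction_on with
    | _ m ih =>
      intro v hv
      rcases m with _ | m
      · simp [h0]
      refine nat_succ_mul_cancel m ?_
      -- Newton for `x ↦ Z(x ∗ v)` versus Newton's recursion for `Z`, multiplied by `Z v`
      have hn := newton_sumStuffle (fun x => sumStuffle Z x v) m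
      rw [← mul_assoc, hN m, Finset.sum_mul, hn]
      refine Finset.sum_congr rfl fun k hk => ?_
      rw [Finset.mem_range] at hk
      rw [mul_assoc, mul_assoc, ih (m - k) (by omega) v hv, sumStuffle, ← List.sum_map_mul_left,
        sumStuffle, sumStuffle_assoc]
      congr 2
      refine List.map_congr_left fun y hy => ?_
      exact hsing k y (one_le_of_mem_stuffle _ _ (hones _) hv y hy)
  -- general `u`: peel its leading ones
  refine stuffleChar_of_ones Z hadm hu (fun l => ?_) v hv
  rw [mul_comm, hrep l u hu, sumStuffle_comm]

end Engine

/-! ## A.4 One-letter coefficients as a power series; Newton's recursion for `exp` -/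

section PowerSeriesBridge

variable {α : Type u} {K : Type*} [CommRing K]

/-- Summing over the deconcatenations of `w` is summing over the cut position. [folklore] -/
theorem sum_splits_eq_sum_range {M : Type*} [AddCommMonoid M] (w : List α)
    (G : List α × List α → M) :
    ∑ p ∈ splits w, G p = ∑ k ∈ Finset.range (w.length + 1), G (w.take k, w.drop k) := by
  rw [splits, Finset.sum_map]
  exact Fin.sum_univ_eq_sum_range (fun k => G (w.take k, w.drop k)) (w.length + 1)

/-- Deconcatenations of `x w`: the empty prefix, or `x` followed by a deconcatenation of `w`.
[folklore] -/
theorem sum_splits_cons {M : Type*} [AddCommMonoid M] (x : α) (w : List α)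
    (G : List α × List α → M) :
    ∑ p ∈ splits (x :: w), G p = G ([], x :: w) + ∑ p ∈ splits w, G (x :: p.1, p.2) := by
  rw [sum_splits_eq_sum_range, sum_splits_eq_sum_range, List.length_cons, Finset.sum_range_succ']
  simp only [List.take_succ_cons, List.drop_succ_cons, List.take_zero, List.drop_zero]
  rw [add_comm]

/-- On a power of a single letter the Cauchy product is the usual convolution:
`c_{aⁿ}(φ ψ) = Σ_{k ≤ n} c_{aᵏ}(φ) c_{aⁿ⁻ᵏ}(ψ)`. [folklore] -/
theorem mul_apply_replicate (φ ψ : NCSeries α K) (n : ℕ) (a : α) :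
    (φ * ψ) (List.replicate n a) =
      ∑ k ∈ Finset.range (n + 1), φ (List.replicate k a) * ψ (List.replicate (n - k) a) := by
  rw [mul_apply, sum_splits_eq_sum_range, List.length_replicate]
  refine Finset.sum_congr rfl fun k hk => ?_
  rw [Finset.mem_range] at hk
  rw [List.take_replicate, List.drop_replicate, Nat.min_eq_left (by omega)]

/-- A power `Sᵏ` of a series without constant term vanishes on words shorter than `k`. [folklore] -/
theorem pow_apply_eq_zero_of_length_lt {S : NCSeries α K} (hS : S [] = 0) :
    ∀ (k : ℕ) (w : List α), w.length < k → (S ^ k) w = 0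
  | 0, w, hw => absurd hw (Nat.not_lt_zero _)
  | k + 1, w, hw => by
    rw [pow_succ, mul_apply]
    refine Finset.sum_eq_zero ?_
    rintro ⟨u, v⟩ huv
    rw [mem_splits] at huv
    cases v with
    | nil => simp [hS]
    | cons b v =>
      have hu : u.length < k := by
        have := congrArg List.length huv
        simp only [List.length_append, List.length_cons] at this
        omega
      simp [pow_apply_eq_zero_of_length_lt hS k u hu]

/-- **The `Y₁`-part of a series as a one-variable power series**: `ψ ↦ Σₙ c_{Y₁ⁿ}(ψ) Xⁿ` is a
ring homomorphism `R⟨⟨Y⟩⟩ → R⟦X⟧` (the deconcatenations of `Y₁ⁿ` are the `(Y₁ᵏ, Y₁ⁿ⁻ᵏ)`).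
Used to read off the coefficients of `φ_corr = exp(…) ∈ R[[Y₁]]`. [folklore] -/
def toPowerSeries : NCSeries ℕ K →+* PowerSeries K where
  toFun ψ := PowerSeries.mk fun n => ψ (List.replicate n 1)
  map_one' := by
    ext n
    rw [PowerSeries.coeff_mk, PowerSeries.coeff_one]
    cases n with
    | zero => rw [if_pos rfl]; rfl
    | succ n => rw [if_neg (Nat.succ_ne_zero n)]; rfl
  map_mul' ψ χ := by
    ext n
    rw [PowerSeries.coeff_mk, PowerSeries.coeff_mul, mul_apply_replicate,
      Finset.Nat.sum_antidiagonal_eq_sum_range_succ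
        (fun i j => PowerSeries.coeff i (PowerSeries.mk fun n => ψ (List.replicate n 1)) *
          PowerSeries.coeff j (PowerSeries.mk fun n => χ (List.replicate n 1))) n]
    simp only [PowerSeries.coeff_mk]
  map_zero' := by ext; simp
  map_add' ψ χ := by ext; simp

/-- `[Xⁿ] toPowerSeries ψ = c_{Y₁ⁿ}(ψ)`. [folklore] -/
@[simp] theorem coeff_toPowerSeries (ψ : NCSeries ℕ K) (n : ℕ) :
    PowerSeries.coeff n (toPowerSeries ψ) = ψ (List.replicate n 1) :=
  PowerSeries.coeff_mk n fun n => ψ (List.replicate n 1)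

/-- `c_a(exp S) = c_a(S)` on letters. [folklore] -/
theorem exp_apply_singleton [Algebra ℚ K] (S : NCSeries α K) (a : α) : exp S [a] = S [a] := by
  simp [exp, Finset.sum_range_succ]

variable [Algebra ℚ K]

open PowerSeries in
/-- **Newton's recursion for the exponential** (`E = exp C ⇒ X E' = E · X C'`): for a series `C`
without constant term, the coefficients `eₙ = c_{Y₁ⁿ}(exp C)`, `cₙ = c_{Y₁ⁿ}(C)` satisfy
`(m+1) e_{m+1} = Σ_{k=0}^{m} (k+1) c_{k+1} e_{m-k}`. Proof: in `K⟦X⟧`, the truncations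
`E_M = Σ_{k ≤ M} sᵏ/k!` of `exp s` (`s = toPowerSeries C`) satisfy `d/dX E_{M+1} = E_M · s'`
(`Derivation.leibniz_pow`), and `[Xⁿ] E_M = eₙ` for `n ≤ M`. [folklore] -/
theorem exp_replicate_recursion {C : NCSeries ℕ K} (hC : C [] = 0) (m : ℕ) :
    ((m + 1 : ℕ) : K) * exp C (List.replicate (m + 1) 1) =
      ∑ k ∈ Finset.range (m + 1), ((k + 1 : ℕ) : K) * C (List.replicate (k + 1) 1) *
        exp C (List.replicate (m - k) 1) := by
  set s : PowerSeries K := toPowerSeries C with hs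
  -- truncated exponentials
  set E : ℕ → PowerSeries K := fun M =>
    ∑ k ∈ Finset.range (M + 1), algebraMap ℚ K (1 / (k.factorial : ℚ)) • s ^ k with hE
  have hcoeffpow : ∀ {k n : ℕ}, n < k → PowerSeries.coeff n (s ^ k) = 0 := fun {k n} h => by
    rw [hs, ← map_pow, coeff_toPowerSeries]
    exact pow_apply_eq_zero_of_length_lt hC k _ (by simpa using h)
  have hcoeffE : ∀ {M n : ℕ}, n ≤ M → PowerSeries.coeff n (E M) = exp C (List.replicate n 1) := by
    intro M n hnM
    simp only [hE, map_sum, PowerSeries.coeff_smul, smul_eq_mul]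
    rw [exp, List.length_replicate]
    have hterm : ∀ k, PowerSeries.coeff n (s ^ k) = (C ^ k) (List.replicate n 1) := fun k => by
      rw [hs, ← map_pow, coeff_toPowerSeries]
    simp only [hterm]
    symm
    refine Finset.sum_subset (Finset.range_subset_range.mpr (by omega)) fun k hk hk' => ?_
    rw [Finset.mem_range] at hk hk'
    rw [pow_apply_eq_zero_of_length_lt hC k _ (by simp only [List.length_replicate]; omega),
      mul_zero]
  -- d/dX (sʲ⁺¹/(j+1)!) = (sʲ/j!) s'
  have hterm : ∀ j : ℕ, d⁄dX K (algebraMap ℚ K (1 / ((j + 1).factorial : ℚ)) • s ^ (j + 1)) =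
      (algebraMap ℚ K (1 / (j.factorial : ℚ)) • s ^ j) * d⁄dX K s := by
    intro j
    rw [Derivation.map_smul, Derivation.leibniz_pow, Nat.add_sub_cancel, smul_eq_mul,
      ← Nat.cast_smul_eq_nsmul K, smul_smul, smul_mul_assoc]
    congr 1
    rw [← map_natCast (algebraMap ℚ K), ← map_mul]
    congr 1
    rw [Nat.factorial_succ]
    push_cast
    field_simp
  -- d/dX E_{M+1} = E_M · s'
  have hD : ∀ M : ℕ, d⁄dX K (E (M + 1)) = E M * d⁄dX K s := by
    intro M
    simp only [hE]
    rw [map_sum, Finset.sum_range_succ', Finset.sum_mul, pow_zero, Derivation.map_smul,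
      Derivation.map_one_eq_zero, smul_zero, add_zero]
    exact Finset.sum_congr rfl fun j _ => hterm j
  -- compare the coefficients of X^m in `hD m`
  have h := congrArg (PowerSeries.coeff m) (hD m)
  rw [coeff_derivative, hcoeffE le_rfl, PowerSeries.coeff_mul, ← Finset.Nat.sum_antidiagonal_swap]
    at h
  simp only [Prod.fst_swap, Prod.snd_swap] at h
  rw [Finset.Nat.sum_antidiagonal_eq_sum_range_succ
    (fun i j => PowerSeries.coeff j (E m) * PowerSeries.coeff i (d⁄dX K s)) m] at h
  have h' : ((m + 1 : ℕ) : K) * exp C (List.replicate (m + 1) 1) =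
      ∑ k ∈ Finset.range (m + 1),
        exp C (List.replicate (m - k) 1) * (C (List.replicate (k + 1) 1) * ((k : K) + 1)) := by
    rw [mul_comm]
    push_cast
    rw [h]
    refine Finset.sum_congr rfl fun k _ => ?_
    rw [hcoeffE (Nat.sub_le m k), coeff_derivative, hs, coeff_toPowerSeries]
  rw [h']
  refine Finset.sum_congr rfl fun k _ => ?_
  push_cast
  ring

end PowerSeriesBridge

/-! ## A.5 Part A assembled: the convergent series shuffle formulas imply `Δ_*(φ_*) = φ_* ⊗̂ φ_*` -/

section PartA

variable {K : Type v} [CommRing K] [Algebra ℚ K]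

omit [Algebra ℚ K] in
/-- `c_{Y₁ʲ}(π_Y φ) = (-1)ʲ c_{X₁ʲ}(φ)`; it vanishes for `j ≥ 1` when `c_{X₁ʲ}(φ) = 0`. [folklore] -/
theorem piY_apply_replicate_one (φ : NCSeries Bool K) (j : ℕ) :
    piY φ (List.replicate j 1) = (-1) ^ j * φ (List.replicate j true) := by
  rw [piY_apply_of_forall_pos φ fun i hi => by rw [List.eq_of_mem_replicate hi],
    List.length_replicate, MZV.binaryWord_replicate_one]

/-- **`φ_*` on `Y₁ˡ`**: `c_{Y₁ˡ}(φ_*) = c_{Y₁ˡ}(φ_corr)` when `c_∅(φ) = 1` and `c_{X₁ʲ}(φ) = 0`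
(`j ≥ 1`). [cite: Furusho2011, §2] -/
theorem seriesShuffleReg_apply_replicate_one {φ : NCSeries Bool K} (h0 : φ [] = 1)
    (h1 : ∀ j, 1 ≤ j → φ (List.replicate j true) = 0) (l : ℕ) :
    seriesShuffleReg φ (List.replicate l 1) = corr φ (List.replicate l 1) := by
  rw [seriesShuffleReg, mul_apply_replicate, Finset.sum_eq_single_of_mem l (by simp) ?_]
  · simp [h0]
  · intro k hk hkl
    rw [Finset.mem_range] at hk
    rw [piY_apply_replicate_one, h1 (l - k) (by omega), mul_zero, mul_zero]

omit [Algebra ℚ K] in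
/-- A word all of whose letters are `1` is `1^{|w|}`. [folklore] -/
theorem eq_replicate_of_forall_eq_one {w : List ℕ} (hw : ∀ i ∈ w, i = 1) :
    w = List.replicate w.length 1 :=
  List.eq_replicate_iff.mpr ⟨rfl, hw⟩

/-- **`φ_*` coefficientwise**: `c_u(φ_*) = Σ_{u = 1ʲ u'} c_{Y₁ʲ}(φ_corr) c_{u'}(π_Y φ)` — the
correction term is supported on the powers of `Y₁`. [cite: Furusho2011, §2] -/
theorem seriesShuffleReg_apply_eq_sum_splits (φ : NCSeries Bool K) (u : List ℕ) :
    seriesShuffleReg φ u = ∑ p ∈ splits u,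
      if (∀ i ∈ p.1, i = 1) then corr φ (List.replicate p.1.length 1) * piY φ p.2 else 0 := by
  rw [seriesShuffleReg, mul_apply]
  refine Finset.sum_congr rfl fun p _ => ?_
  split_ifs with h
  · rw [← eq_replicate_of_forall_eq_one h]
  · rw [corr_apply_eq_zero φ (by simpa using h), zero_mul]

omit [Algebra ℚ K] in
/-- **Harmonic products with `1ˡ` against a `Y₁`-supported left factor** (the bookkeeping behind
Furusho's use of `e^{-TY₁} φ_*`, §4): for `s = a s'` with `a ≥ 2` and
`F(u) = Σ_{u = 1ʲ u'} c_j g(u')`,  `Σ_{u ∈ s ∗ 1ˡ} F(u) = Σ_{j ≤ l} c_j Σ_{u' ∈ s ∗ 1^{l-j}} g(u')`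
(an index of `s ∗ 1ˡ` begins with `1ʲ` exactly when it is `1ʲ` followed by an index of
`s ∗ 1^{l-j}`). [cite: Furusho2011, §4] -/
theorem sumStuffle_replicate_one_splits (c : ℕ → K) (g : List ℕ → K) {a : ℕ} (ha : 2 ≤ a)
    (s' : List ℕ) : ∀ l : ℕ,
    sumStuffle (fun u => ∑ p ∈ splits u,
        if (∀ i ∈ p.1, i = 1) then c p.1.length * g p.2 else 0) (a :: s') (List.replicate l 1) =
      ∑ j ∈ Finset.range (l + 1), c j * sumStuffle g (a :: s') (List.replicate (l - j) 1) := by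
  -- the summand on a word with head `x`
  have hcons : ∀ (c : ℕ → K) (x : ℕ) (w : List ℕ),
      (∑ p ∈ splits (x :: w), if (∀ i ∈ p.1, i = 1) then c p.1.length * g p.2 else 0) =
        c 0 * g (x :: w) + if x = 1 then
          ∑ p ∈ splits w, (if (∀ i ∈ p.1, i = 1) then c (p.1.length + 1) * g p.2 else 0) else 0 := by
    intro c x w
    rw [sum_splits_cons]
    simp only [List.not_mem_nil, IsEmpty.forall_iff, implies_true, ↓reduceIte, List.length_nil,
      List.mem_cons, forall_eq_or_imp, List.length_cons]
    congr 1
    split_ifs with hx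
    · simp [hx]
    · simp [hx]
  intro l
  induction l generalizing c with
  | zero =>
    simp only [List.replicate_zero, sumStuffle_nil_right, zero_add, Finset.range_one,
      Finset.sum_singleton, Nat.sub_zero]
    rw [hcons, if_neg (by omega), add_zero]
  | succ l ih =>
    rw [List.replicate_succ, sumStuffle_cons_cons, ← List.replicate_succ]
    have e1 : (fun u => ∑ p ∈ splits u, if (∀ i ∈ p.1, i = 1) then c p.1.length * g p.2 else 0) ∘
        List.cons a = fun w => c 0 * g (a :: w) := by
      funext w; simp only [Function.comp_apply]; rw [hcons, if_neg (by omega), add_zero]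
    have e2 : (fun u => ∑ p ∈ splits u, if (∀ i ∈ p.1, i = 1) then c p.1.length * g p.2 else 0) ∘
        List.cons (a + 1) = fun w => c 0 * g ((a + 1) :: w) := by
      funext w; simp only [Function.comp_apply]; rw [hcons, if_neg (by omega), add_zero]
    have e3 : (fun u => ∑ p ∈ splits u, if (∀ i ∈ p.1, i = 1) then c p.1.length * g p.2 else 0) ∘
        List.cons 1 = (fun w => c 0 * g (1 :: w)) + fun w =>
          ∑ p ∈ splits w, (if (∀ i ∈ p.1, i = 1) then c (p.1.length + 1) * g p.2 else 0) := by
      funext w; simp only [Function.comp_apply, Pi.add_apply]; rw [hcons, if_pos rfl]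
    rw [e1, e2, e3, sumStuffle_add, ih (fun j => c (j + 1)), Finset.sum_range_succ' _ (l + 1)]
    simp only [Nat.add_sub_add_right, Nat.sub_zero]
    -- the three `c 0` terms reassemble `c 0 · Σ_{u ∈ s ∗ 1^{l+1}} g u`
    have e4 : c 0 * sumStuffle g (a :: s') (List.replicate (l + 1) 1) =
        sumStuffle (fun w => c 0 * g (a :: w)) s' (List.replicate (l + 1) 1) +
          sumStuffle (fun w => c 0 * g (1 :: w)) (a :: s') (List.replicate l 1) +
          sumStuffle (fun w => c 0 * g ((a + 1) :: w)) s' (List.replicate l 1) := by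
      rw [List.replicate_succ, sumStuffle_cons_cons, ← List.replicate_succ, mul_add, mul_add]
      simp only [sumStuffle, ← List.sum_map_mul_left, Function.comp_def]
    rw [e4]
    ring

/-- **Part A of Furusho's proof (§4, Prop. 4.2 and the end of the proof of Thm 2.1), parameter-free
form.** Let `φ ∈ K⟨⟨X₀,X₁⟩⟩` (`K` a commutative `ℚ`-algebra) have `c_∅(φ) = 1` and `c_{X₁ʲ}(φ) = 0`
for `j ≥ 1` (e.g. `φ` group-like with `c_{X₁}(φ) = 0`). Suppose the coefficients
`l_s(φ) = c_s(π_Y φ)` satisfy the **series shuffle formula for admissible indices**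
`l_s(φ) l_t(φ) = Σ_{u ∈ s ∗ t} l_u(φ)` [Furusho2011, (series shuffle for l), from Lemmas 5.1–5.2]
and the vanishing `Σ_{u ∈ s ∗ 1ˡ} l_u(φ) = 0` for `s ≠ ∅` admissible and `l ≥ 1` [the
`T⁰`-coefficient of Furusho's second family, from Lemmas 5.3–5.4]. Then `φ` satisfies the
generalised double shuffle relation `Δ_*(φ_*) = φ_* ⊗̂ φ_*`. (Furusho derives this through
Hoffman's regularisation `l^S`, the map `𝕃` and Prop. 4.2 `l^S = 𝕃(l^I)`; here the engine
`stuffleChar_of_admissible` is applied directly to `Z = c_•(φ_*)`, Newton's recursion for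
`Z(1^m) = c_{Y₁ᵐ}(φ_corr)` coming from `φ_corr = exp(Σ ((-1)ⁿ/n) c_{X₀ⁿ⁻¹X₁}(φ) Y₁ⁿ)`.)
[cite: Furusho2011, §4] -/
theorem generalisedDoubleShuffle_of_piY {φ : NCSeries Bool K} (h0 : φ [] = 1)
    (h1 : ∀ j, 1 ≤ j → φ (List.replicate j true) = 0)
    (hI1 : ∀ s t, IsAdmissible s → IsAdmissible t →
      piY φ s * piY φ t = ((stuffle s t).map (piY φ)).sum)
    (hI2 : ∀ s, IsAdmissible s → s ≠ [] → ∀ l, 1 ≤ l →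
      ((stuffle s (List.replicate l 1)).map (piY φ)).sum = 0) :
    GeneralisedDoubleShuffle φ := by
  set Z : List ℕ → K := seriesShuffleReg φ with hZ
  have hZadm : ∀ s, IsAdmissible s → Z s = piY φ s := fun s hs => by
    rw [hZ, seriesShuffleReg_apply_of_isAdmissible φ hs, piY_apply_of_forall_pos φ hs.1]
  have hZ0 : Z [] = 1 := by rw [hZadm [] isAdmissible_nil, piY_apply_nil, h0]
  have hZone : ∀ l, Z (List.replicate l 1) = corr φ (List.replicate l 1) :=
    seriesShuffleReg_apply_replicate_one h0 h1
  -- (H1)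
  have H1 : ∀ s t, IsAdmissible s → IsAdmissible t → Z s * Z t = sumStuffle Z s t := by
    intro s t hs ht
    rw [hZadm s hs, hZadm t ht, hI1 s t hs ht, sumStuffle]
    exact congrArg List.sum (List.map_congr_left fun u hu =>
      (hZadm u (isAdmissible_of_mem_stuffle hs ht hu)).symm)
  -- (H2)
  have H2 : ∀ s, IsAdmissible s → ∀ l : ℕ,
      Z s * Z (List.replicate l 1) = sumStuffle Z s (List.replicate l 1) := by
    intro s hs l
    cases s with
    | nil => rw [hZ0, one_mul, sumStuffle_nil_left]
    | cons a s' =>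
      have ha : 2 ≤ a := by simpa using hs.2 (List.cons_ne_nil a s')
      rw [hZadm _ hs, hZone l]
      have hF : Z = fun u => ∑ p ∈ splits u,
          if (∀ i ∈ p.1, i = 1) then corr φ (List.replicate p.1.length 1) * piY φ p.2 else 0 :=
        funext (seriesShuffleReg_apply_eq_sum_splits φ)
      rw [hF, sumStuffle_replicate_one_splits (fun j => corr φ (List.replicate j 1)) (piY φ) ha s' l,
        Finset.sum_range_succ, Finset.sum_eq_zero fun j hj => ?_]
      · simp [mul_comm]
      · rw [Finset.mem_range] at hj
        rw [sumStuffle, hI2 _ hs (List.cons_ne_nil a s') (l - j) (by omega), mul_zero]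
  -- Newton's recursion for Z(1^m) = c_{Y₁^m}(φ_corr)
  have HN : ∀ m : ℕ, ((m + 1 : ℕ) : K) * Z (List.replicate (m + 1) 1) =
      ∑ k ∈ Finset.range (m + 1), (-1) ^ k * (Z [k + 1] * Z (List.replicate (m - k) 1)) := by
    intro m
    rw [hZone, corr, exp_replicate_recursion (corrLog_apply_nil φ) m]
    refine Finset.sum_congr rfl fun k hk => ?_
    rw [hZone, corr, corrLog_apply_replicate φ (Nat.succ_ne_zero k)]
    have hφ1 : φ [true] = 0 := by simpa using h1 1 le_rfl
    rcases k with _ | k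
    · -- both sides vanish: c_{X₁}(φ) = 0 and Z(y₁) = c_{Y₁}(φ_corr) = c_{Y₁}(corrLog φ) = 0
      have hc1 : corrLog φ [1] = 0 := by
        rw [show ([1] : List ℕ) = List.replicate 1 1 from rfl, corrLog_apply_replicate φ one_ne_zero]
        simp [MZV.binaryWord, hφ1]
      have hZ1 : Z [1] = 0 := by
        rw [show ([1] : List ℕ) = List.replicate 1 1 from rfl, hZone 1, corr, List.replicate_one,
          exp_apply_singleton, hc1]
      simp [MZV.binaryWord, hφ1, hZ1]
    · rw [hZadm [k + 1 + 1] ⟨by simp, fun _ => by simp⟩,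
        piY_apply_singleton φ (by omega : 1 ≤ k + 1 + 1)]
      rw [← map_natCast (algebraMap ℚ K), ← mul_assoc, ← map_mul]
      rw [show ((k + 1 + 1 : ℕ) : ℚ) * ((-1) ^ (k + 1 + 1) / (k + 1 + 1 : ℕ)) = (-1) ^ k by
        push_cast; field_simp; ring]
      rw [map_pow, map_neg, map_one]
      ring
  intro u v hu hv
  exact stuffleChar_of_admissible Z hZ0 H1 H2 HN u v hu hv

end PartA

end NCSeries

end Literature.NumberTheory.Transcendental
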